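import Literature.AnabelianGeometry.AbsoluteAnabelian.DiagramsOfCategories

/-!
# Cores of diagrams of categories from "structure functors" ([AbsTopIII] Def. 3.5 (iii), toolkit)

S. Mochizuki, *Topics in Absolute Anabelian Geometry III*, Def. 3.5 (iii) p. 75 (manuscript
`paper:url-5493eb38cbb7`, bib key `MochizukiAbsTopIII2015`) defines a **core** on a diagram of
categories `𝒟` as an observable `(𝒮, v_𝒮, ℋ)` whose family of homotopies `ℋ` relates ALL
co-verticial pairs of paths ending at the observation vertex.  Remark 3.5.1 p. 78 glosses: "one
may think of a core as a sort of 'constant portion' of the diagram that lies, in a consistent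
fashion, 'under the entire diagram'".  This file makes that gloss a CONSTRUCTION over the honest
definitions of `DiagramsOfCategories.lean` (seat abc-iut-L4-t2): if every category `𝒟_v` comes
with a "structure functor" `N_v : 𝒟_v ⥤ 𝒞` and every functor `𝒟_e` of the diagram lies over `𝒞`
up to a given isomorphism `μ_e : 𝒟_e ⋙ N_{v₂} ≅ N_{v₁}` (`OverData`), then composing the `μ_e`
along paths gives canonical isomorphisms `𝒟_[γ] ⋙ N ≅ N` (`OverData.pathIso`), and on a diagram
extended by an observation vertex carrying `𝒞` itself these yield a family of homotopies relating
all co-verticial pairs of paths into that vertex (`coreFamily`), which is a core as soon as every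
vertex reaches the observation vertex (`isCore_coreObservable`).  This is exactly the mechanism of
the proof of [AbsTopIII] Cor. 3.6 (i) p. 80 ("immediate from the definitions and the fact that
the algorithms of Corollary 1.10 are 'group-theoretic'", i.e. every functor of the diagram lies
over the Galois group), used in `FrobeniusPictureMLFCores.lean` to DISCHARGE Cor. 3.6 (i).

Everything here is elementary category theory (whiskering and `eqToHom` bookkeeping forced by
the fact that `pathFunctor` is defined by well-founded recursion); no claim of the paper is
asserted.  Tagged `[folklore]` except where a printed sentence is implemented.
-/

namespace Literature.AnabelianGeometry.AbsoluteAnabelian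

open _root_.CategoryTheory _root_.Quiver

universe v u w

namespace DiagramOfCategories

variable {V : Type w} [Quiver.{v} V]

/-! ### Paths out of a vertex without outgoing edges -/

/-- If a vertex `ω` has no outgoing edges, every path starting at `ω` ends at `ω`. [folklore] -/
private theorem eq_of_path_out {ω : V} (hout : ∀ b : V, IsEmpty (ω ⟶ b)) :
    ∀ {b : V} (_ : Path ω b), b = ω
  | _, .nil => rfl
  | _, .cons r e => by
    obtain rfl := eq_of_path_out hout r
    exact ((hout _).false e).elim

/-- If a vertex `ω` has no outgoing edges, the only path `ω ⟶ ω` is the empty path. [folklore] -/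
private theorem path_out_eq_nil {ω : V} (hout : ∀ b : V, IsEmpty (ω ⟶ b)) (r : Path ω ω) :
    r = Path.nil := by
  cases r with
  | nil => rfl
  | cons r e =>
    obtain rfl := eq_of_path_out hout r
    exact ((hout _).false e).elim

variable (D : DiagramOfCategories.{v, u, w} V)

/-! ### Structure functors to a fixed category -/

/-- **Structure functors over a category `𝒞`**: a functor `N_v : 𝒟_v ⥤ 𝒞` at every vertex and,
for every edge `e : v₁ ⟶ v₂`, an isomorphism `μ_e : 𝒟_e ⋙ N_{v₂} ≅ N_{v₁}` — "every functor of the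
diagram lies over `𝒞`" (Rmk. 3.5.1: the core as a "constant portion … under the entire diagram").
[cite: MochizukiAbsTopIII2015, Remark 3.5.1 p.78] -/
structure OverData (C : Type u) [Category.{v} C] : Type (max w (v+1) (u+1)) where
  /-- The structure functor `N_v : 𝒟_v ⥤ 𝒞`. -/
  N : ∀ a : V, D.obj a ⥤ C
  /-- `𝒟_e` lies over `𝒞`: `𝒟_e ⋙ N_{v₂} ≅ N_{v₁}`. -/
  μ : ∀ {a b : V} (e : a ⟶ b), D.map e ⋙ N b ≅ N a

namespace OverData

variable {D}
variable {C : Type u} [Category.{v} C] (O : D.OverData C)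

/-- Post-composition of structure functors with a functor `F : 𝒞 ⥤ 𝒞'` ("`𝒞'` lies under `𝒞`").
[folklore] -/
def map {C' : Type u} [Category.{v} C'] (F : C ⥤ C') : D.OverData C' where
  N a := O.N a ⋙ F
  μ e := Functor.isoWhiskerRight (O.μ e) F

/-- The isomorphism `𝒟_[γ] ⋙ N_{v₂} ≅ N_{v₁}` along a path `γ : v₁ ⟶ v₂`, composed from the `μ_e`
(the `eqToIso` inserts the defining equations of `pathFunctor`, which holds them only
propositionally). [folklore] -/
noncomputable def pathIso : ∀ {a b : V} (p : Path a b), D.pathFunctor p ⋙ O.N b ≅ O.N a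
  | _, _, .nil => eqToIso (by rw [pathFunctor_nil]; rfl)
  | _, _, .cons p e =>
    eqToIso (show D.pathFunctor (p.cons e) ⋙ O.N _ = D.pathFunctor p ⋙ (D.map e ⋙ O.N _) by
        rw [pathFunctor_cons]; rfl) ≪≫
      Functor.isoWhiskerLeft (D.pathFunctor p) (O.μ e) ≪≫ pathIso p

/-- Components of `pathIso` on the empty path. [folklore] -/
private theorem pathIso_nil_hom_app (a : V) (x : D.obj a) :
    (O.pathIso (Path.nil : Path a a)).hom.app x = eqToHom (by rw [pathFunctor_nil]; rfl) := by
  rw [pathIso]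
  simp only [eqToIso.hom, eqToHom_app]

/-- Components of `pathIso` on an extended path. [folklore] -/
private theorem pathIso_cons_hom_app {a b c : V} (p : Path a b) (e : b ⟶ c) (x : D.obj a) :
    (O.pathIso (p.cons e)).hom.app x =
      eqToHom (by rw [pathFunctor_cons]; rfl) ≫ (O.μ e).hom.app ((D.pathFunctor p).obj x) ≫
        (O.pathIso p).hom.app x := by
  rw [pathIso]
  simp only [Iso.trans_hom, eqToIso.hom, NatTrans.comp_app, eqToHom_app,
    Functor.isoWhiskerLeft_hom, Functor.whiskerLeft_app]
  rfl

/-- Transport of the components of `μ_e` along an equality of objects. [folklore] -/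
private theorem μ_hom_app_congr {b c : V} (e : b ⟶ c) {y y' : D.obj b} (hy : y = y') :
    (O.μ e).hom.app y =
      eqToHom (by rw [hy]) ≫ (O.μ e).hom.app y' ≫ eqToHom (by rw [hy]) := by
  subst hy
  simp

/-- `pathIso` along a composite path, componentwise: `pathIso (r ∘ p) = pathIso r ∘ (r ◁ pathIso p)`
up to the `eqToHom` of `pathFunctor_comp`. [folklore] -/
private theorem pathIso_comp_hom_app {a b c : V} (r : Path a b) (p : Path b c) (x : D.obj a) :
    (O.pathIso (r.comp p)).hom.app x =
      eqToHom (by rw [pathFunctor_comp]; rfl) ≫ (O.pathIso p).hom.app ((D.pathFunctor r).obj x) ≫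
        (O.pathIso r).hom.app x := by
  induction p with
  | nil =>
    simp only [Path.comp_nil, pathIso_nil_hom_app, eqToHom_trans_assoc]
    erw [eqToHom_refl, Category.id_comp]
  | cons p e ih =>
    simp only [Path.comp_cons, pathIso_cons_hom_app, ih, Category.assoc]
    rw [O.μ_hom_app_congr e
      (show (D.pathFunctor (r.comp p)).obj x = (D.pathFunctor p).obj ((D.pathFunctor r).obj x) by
        rw [pathFunctor_comp]; rfl)]
    simp only [Category.assoc, eqToHom_trans_assoc]
    congr 2
    erw [eqToHom_trans_assoc, eqToHom_refl, Category.id_comp]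
    rfl

/-- `pathIso` along a composite path, as an equality of natural isomorphisms. [folklore] -/
private theorem pathIso_comp {a b c : V} (r : Path a b) (p : Path b c) :
    O.pathIso (r.comp p) =
      eqToIso (show D.pathFunctor (r.comp p) ⋙ O.N c = D.pathFunctor r ⋙ (D.pathFunctor p ⋙ O.N c) by
          rw [pathFunctor_comp]; rfl) ≪≫
        Functor.isoWhiskerLeft (D.pathFunctor r) (O.pathIso p) ≪≫ O.pathIso r := by
  ext x
  rw [pathIso_comp_hom_app]
  simp only [Iso.trans_hom, eqToIso.hom, NatTrans.comp_app, eqToHom_app, Functor.isoWhiskerLeft_hom,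
    Functor.whiskerLeft_app]
  rfl

end OverData

/-! ### The core determined by structure functors -/

section Core

variable {W : Type w} [Quiver.{v} W] (S : DiagramOfCategories.{v, u, w} W) (ω : W)
  (O : S.OverData (S.obj ω)) (ε : O.N ω ≅ 𝟭 (S.obj ω))

/-- The "generic homotopy": for functors `F, G` into `𝒮_ω` identified with `M` after composing
with the structure functor `N_ω ≅ 𝟭`, the natural transformation `F ⟶ G` through `M`. [folklore] -/
noncomputable def coreHom' {A : Type u} [Category.{v} A] (F G : A ⥤ S.obj ω) {M : A ⥤ S.obj ω}
    (i : F ⋙ O.N ω ≅ M) (j : G ⋙ O.N ω ≅ M) : F ⟶ G :=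
  F.rightUnitor.inv ≫ Functor.whiskerLeft F ε.inv ≫ i.hom ≫ j.inv ≫ Functor.whiskerLeft G ε.hom ≫
    G.rightUnitor.hom

/-- `coreHom'` of a functor with itself is the identity. [folklore] -/
private theorem coreHom'_self {A : Type u} [Category.{v} A] (F : A ⥤ S.obj ω) {M : A ⥤ S.obj ω}
    (i : F ⋙ O.N ω ≅ M) : coreHom' S ω O ε F F i i = 𝟙 F := by
  rw [coreHom', Iso.hom_inv_id_assoc, ← Functor.whiskerLeft_comp_assoc, Iso.inv_hom_id,
    Functor.whiskerLeft_id', Category.id_comp, Iso.inv_hom_id]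

/-- `coreHom'` is transitive. [folklore] -/
private theorem coreHom'_trans {A : Type u} [Category.{v} A] (F G H : A ⥤ S.obj ω) {M : A ⥤ S.obj ω}
    (i : F ⋙ O.N ω ≅ M) (j : G ⋙ O.N ω ≅ M) (k : H ⋙ O.N ω ≅ M) :
    coreHom' S ω O ε F G i j ≫ coreHom' S ω O ε G H j k = coreHom' S ω O ε F H i k := by
  simp only [coreHom', Category.assoc, Iso.hom_inv_id_assoc]
  rw [← Functor.whiskerLeft_comp_assoc, Iso.hom_inv_id, Functor.whiskerLeft_id', Category.id_comp,
    Iso.inv_hom_id_assoc]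

/-- `coreHom'` does not see a common post-composed isomorphism. [folklore] -/
private theorem coreHom'_postcomp {A : Type u} [Category.{v} A] (F G : A ⥤ S.obj ω) {M M' : A ⥤ S.obj ω}
    (i : F ⋙ O.N ω ≅ M) (j : G ⋙ O.N ω ≅ M) (k : M ≅ M') :
    coreHom' S ω O ε F G (i ≪≫ k) (j ≪≫ k) = coreHom' S ω O ε F G i j := by
  simp only [coreHom', Iso.trans_hom, Iso.trans_inv, Category.assoc, Iso.hom_inv_id_assoc]

/-- Whiskering a `coreHom'` on the left. [folklore] -/
private theorem whiskerLeft_coreHom' {A B : Type u} [Category.{v} A] [Category.{v} B] (R : B ⥤ A)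
    (F G : A ⥤ S.obj ω) {M : A ⥤ S.obj ω} (i : F ⋙ O.N ω ≅ M) (j : G ⋙ O.N ω ≅ M) :
    Functor.whiskerLeft R (coreHom' S ω O ε F G i j) =
      coreHom' S ω O ε (R ⋙ F) (R ⋙ G) (Functor.isoWhiskerLeft R i) (Functor.isoWhiskerLeft R j) := by
  ext x
  simp only [coreHom', Functor.whiskerLeft_app, NatTrans.comp_app, Functor.rightUnitor_inv_app,
    Functor.rightUnitor_hom_app, Functor.isoWhiskerLeft_hom, Functor.isoWhiskerLeft_inv]
  rfl

/-- `coreHom'` respects (heterogeneous) equality of its inputs. [folklore] -/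
private theorem coreHom'_heq {A : Type u} [Category.{v} A] {F F' G G' : A ⥤ S.obj ω} {M : A ⥤ S.obj ω}
    (hF : F = F') (hG : G = G') {i : F ⋙ O.N ω ≅ M} {i' : F' ⋙ O.N ω ≅ M} {j : G ⋙ O.N ω ≅ M}
    {j' : G' ⋙ O.N ω ≅ M} (hi : HEq i i') (hj : HEq j j') :
    HEq (coreHom' S ω O ε F G i j) (coreHom' S ω O ε F' G' i' j') := by
  subst hF hG
  cases hi
  cases hj
  rfl

/-- Absorbing an `eqToIso` prefix into a heterogeneous equality. [folklore] -/
private theorem heq_eqToIso_trans {C : Type*} [Category C] {X X' Y : C}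
    (h : X = X') (e : X' ≅ Y) : HEq (eqToIso h ≪≫ e) e := by
  subst h
  simp

/-- Conjugation by `eqToHom`s from a heterogeneous equality (a variant of
`conj_eqToHom_iff_heq` with the second equation in the direction used by
`HomotopyFamily.η_whisker`). [folklore] -/
private theorem eq_conj_eqToHom_of_heq {C : Type*} [Category C] {W X Y Z : C}
    {f : W ⟶ X} {g : Y ⟶ Z} (h : W = Y) (h' : Z = X) (H : HEq f g) :
    f = eqToHom h ≫ g ≫ eqToHom h' := by
  subst h h'
  simp only [heq_iff_eq] at H
  simp [H]

/-- Whiskering on the right with a functor equal to the identity does nothing, heterogeneously.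
[folklore] -/
private theorem heq_whiskerLeft_whiskerRight_of_eq_id {A B C : Type*}
    [Category A] [Category B] [Category C] (R : A ⥤ B) {F G : B ⥤ C} (α : F ⟶ G) {H : C ⥤ C}
    (hH : H = 𝟭 C) : HEq (Functor.whiskerLeft R (Functor.whiskerRight α H)) (Functor.whiskerLeft R α) := by
  subst hH
  rfl

/-- The canonical natural transformation `𝒮_[γ₁] ⟶ 𝒮_[γ₂]` between the functors of two
co-verticial paths into `ω`, through the structure functors: `𝒮_[γ₁] ≅ N_a ≅ 𝒮_[γ₂]`. [folklore] -/
noncomputable def coreHom {a : W} (p q : Path a ω) : S.pathFunctor p ⟶ S.pathFunctor q :=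
  coreHom' S ω O ε (S.pathFunctor p) (S.pathFunctor q) (O.pathIso p) (O.pathIso q)

/-- `coreHom` along pre-composed paths is, heterogeneously, the whiskering of `coreHom`.
[folklore] -/
private theorem coreHom_comp_heq {c a : W} (r : Path c a) (p q : Path a ω) :
    HEq (coreHom S ω O ε (r.comp p) (r.comp q))
      (Functor.whiskerLeft (S.pathFunctor r) (coreHom S ω O ε p q)) := by
  rw [coreHom, coreHom, whiskerLeft_coreHom', O.pathIso_comp r p, O.pathIso_comp r q]
  refine HEq.trans ?_ (heq_of_eq (coreHom'_postcomp S ω O ε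
    (S.pathFunctor r ⋙ S.pathFunctor p) (S.pathFunctor r ⋙ S.pathFunctor q)
    (Functor.isoWhiskerLeft (S.pathFunctor r) (O.pathIso p))
    (Functor.isoWhiskerLeft (S.pathFunctor r) (O.pathIso q)) (O.pathIso r)))
  exact coreHom'_heq S ω O ε (by rw [pathFunctor_comp]) (by rw [pathFunctor_comp])
    (heq_eqToIso_trans _ _) (heq_eqToIso_trans _ _)

variable (hout : ∀ b : W, IsEmpty (ω ⟶ b))

/-- **The core family** (Def. 3.5 (iii): boundary set = "all co-verticial pairs of paths … with
terminal vertex equal to `v_𝒮`") determined by structure functors over the category at a vertex `ω`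
without outgoing edges: the boundary set is `{(γ₁, γ₂) | γ₁, γ₂ end at ω}`, the homotopies are the
`coreHom`. [cite: MochizukiAbsTopIII2015, Definition 3.5 (iii) p.75] -/
noncomputable def coreFamily : S.HomotopyFamily where
  E := fun _ b _ _ => b = ω
  isSaturated :=
    { refl_left := fun _ _ _ _ h => h
      refl_right := fun _ _ _ _ h => h
      trans := fun _ _ _ _ _ h _ => h
      precomp := fun _ _ _ _ _ h _ => h
      postcomp := fun _ b _ _ _ h r => by subst b; exact eq_of_path_out hout r }
  η := fun _ b p q h => by subst b; exact coreHom S ω O ε p q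
  η_refl := by
    intro a b p h
    subst b
    exact coreHom'_self S ω O ε _ _
  η_trans := by
    intro a b p q r h₁ h₂
    subst b
    exact (coreHom'_trans S ω O ε _ _ _ _ _ _).symm
  η_whisker := by
    intro a b c d p q h r₁ r₂
    subst b
    have hd : d = ω := eq_of_path_out hout r₂
    subst d
    have hr : r₂ = Path.nil := path_out_eq_nil hout r₂
    subst hr
    change coreHom S ω O ε (r₁.comp p) (r₁.comp q) = _
    exact eq_conj_eqToHom_of_heq _ _ ((coreHom_comp_heq S ω O ε r₁ p q).trans
      (heq_whiskerLeft_whiskerRight_of_eq_id (S.pathFunctor r₁) (coreHom S ω O ε p q)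
        (S.pathFunctor_nil ω)).symm)

/-- The boundary set of the core family consists of all pairs of paths ending at `ω` (Def. 3.5 (iii):
"the set of all co-verticial pairs of paths … with terminal vertex equal to `v_𝒮`").
[cite: MochizukiAbsTopIII2015, Definition 3.5 (iii) p.75] -/
theorem coreFamily_E {a b : W} (p q : Path a b) :
    (coreFamily S ω O ε hout).E p q ↔ b = ω := Iff.rfl

/-- The homotopies of the core family are the canonical `coreHom` through the structure functors
(Rmk. 3.5.1: the core as the "constant portion" under the diagram).
[cite: MochizukiAbsTopIII2015, Remark 3.5.1 p.78] -/
theorem coreFamily_η {a : W} (p q : Path a ω) (h : (coreFamily S ω O ε hout).E p q) :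
    (coreFamily S ω O ε hout).η h = coreHom S ω O ε p q := rfl

end Core

/-! ### Structure functors on extended diagrams; the core observable -/

/-- In an observable shape (no telecore edges) the observation vertex has no outgoing edges.
[cite: MochizukiAbsTopIII2015, Definition 3.5 (iii) p.75] -/
theorem ExtShape.isEmpty_hom_obs (X : ExtShape.{v} V) (hJ : ∀ a, IsEmpty (X.J a)) :
    ∀ b : X.Vertex, IsEmpty (X.obs ⟶ b)
  | ExtVertex.base b => hJ b
  | ExtVertex.obs => inferInstanceAs (IsEmpty PEmpty)

/-- Structure functors over the observation category of an extension `𝒮 = 𝒟 ∪ {v_𝒮}` without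
telecore edges, from structure functors on `𝒟` over that category compatible with the observation
functors: `N_{v_𝒮} = 𝟭`. [folklore] -/
def OverData.extendCore {X : ExtShape.{v} V} (hJ : ∀ a, IsEmpty (X.J a)) (Y : D.ExtData X)
    (O : D.OverData Y.S) (c : ∀ (a : V) (i : X.I a), Y.obsMap i ≅ O.N a) :
    (D.extend Y).OverData Y.S where
  N a := match a with
    | ExtVertex.base a => O.N a
    | ExtVertex.obs => 𝟭 Y.S
  μ {a b} e := match a, b, e with
    | ExtVertex.base _, ExtVertex.base _, e => O.μ e
    | ExtVertex.base a, ExtVertex.obs, i => (Y.obsMap i).rightUnitor ≪≫ c a i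
    | ExtVertex.obs, ExtVertex.base b, j => ((hJ b).false j).elim
    | ExtVertex.obs, ExtVertex.obs, e => PEmpty.elim e

/-- **The core observable** `(𝒮, v_𝒮, ℋ)` on `𝒟` determined by an observable shape, extension data and
compatible structure functors over the observation category: its family of homotopies is the
`coreFamily`, relating ALL co-verticial pairs of paths into `v_𝒮`.
[cite: MochizukiAbsTopIII2015, Definition 3.5 (iii) p.75] -/
noncomputable def coreObservable (X : ExtShape.{v} V) (hJ : ∀ a, IsEmpty (X.J a))
    (Y : D.ExtData X) (O : D.OverData Y.S) (c : ∀ (a : V) (i : X.I a), Y.obsMap i ≅ O.N a) :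
    D.Observable where
  shape := X
  isEmpty_J := hJ
  ext := Y
  H := coreFamily (D.extend Y) X.obs (OverData.extendCore D hJ Y O c) (Iso.refl _)
    (ExtShape.isEmpty_hom_obs X hJ)
  terminal_obs _ _ _ _ h := h

/-- The core observable IS a core (Def. 3.5 (iii)) as soon as every vertex of `𝒟` reaches the
observation vertex — Rmk. 3.5.1's "constant portion … under the entire diagram" made precise.
[cite: MochizukiAbsTopIII2015, Definition 3.5 (iii) pp.75–76] -/
theorem isCore_coreObservable (X : ExtShape.{v} V) (hJ : ∀ a, IsEmpty (X.J a))
    (Y : D.ExtData X) (O : D.OverData Y.S) (c : ∀ (a : V) (i : X.I a), Y.obsMap i ≅ O.N a)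
    (hreach : ∀ a : V, Nonempty (Path (X.base a) X.obs)) :
    (D.coreObservable X hJ Y O c).IsCore where
  boundary_all _ _ _ := rfl
  reaches_obs := hreach

end DiagramOfCategories

end Literature.AnabelianGeometry.AbsoluteAnabelian
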